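import Summits.QuantumFields.YangMills.Theses.RandomisedStokes
import Summits.QuantumFields.YangMills.Theses.CovariantDischarge
import HarnessLib

/-!
# Route `RandomisedStokes` (planner ym-r3-idea-2 g8, LINE 18 «randomised Stokes»; crux stmt-QuantumFields-19936 `UnitScaleTilt.HistoryTailL`) —
# registered stub `stub_thinOfDeep : CovariantDischarge.DeepWindowTailL → ThinDeepWindowTailL`, BY NAME AND SIGNATURE

The thin residual `ThinDeepWindowTailL` (item stmt-QuantumFields-23919, the 1:1 restate of 23886 after critic #209) is the first-exit window
schema on the SLIVER `(j+1)^N > p(g_{K−j})`, `N ≤ p₀`; the shared residual `CovariantDischarge.DeepWindowTailL` (stmt-QuantumFields-22892) is the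
same schema on every LINEAR window `K < N₁·j`.  This file proves the registered stub of the skeleton
`Cruxes/HistoryTailL/Lines/randomised_stokes.lean` («M: the sliver lies in a linear window»): with `t := b₀^{1/p₀}` one has
`p(g_h) = (t(1 + log g_h⁻¹))^{p₀}` and `1 + log g_h⁻¹ ≥ h·log L/2` (`h = K − j`, `γ ≤ 1`), while `(j+1)^N ≤ (j+1)^{p₀}`; so the sliver forces
`t·h·log L/2 < j + 1 ≤ 2j`, i.e. `K < N₁·j` with `N₁ := ⌈4/(t·log L)⌉₊ + 1` (`sliver_linear_window`), and 22892 at that `N₁` is the claim.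
The Prop `ThinDeepWindowTailL` is reproduced VERBATIM from the skeleton (byte-identical to the route decl, `thinDeepWindowTailL_iff`), so the
skeleton's stub is discharged by definitional unfolding; `thinDeepWindowTailL_of_deepWindowTailL` states the door between the two ROUTE decls BY NAME.

Width seat ym-line-sfw-p2-w3 g32 (cell ym-idea-1, R3 family; free hands).  HONEST FRAMING: 22892 (organ-class residual, open-problem) and every
other crux of the line stay OPEN; this is window arithmetic only; no crux, rung or summit is proved; `YM3TorusSU2` and the Yang–Mills mass gap
are NOT proved.  R3 is a RECORD rung.
-/

set_option autoImplicit false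

namespace Summit.QuantumFields.YangMills.Theorems.RandomisedStokes

open scoped BigOperators Topology Classical MeasureTheory ProbabilityTheory Matrix
open MeasureTheory

/-- = the skeleton's / the route's `ThinDeepWindowTailL` (stmt-QuantumFields-23919; byte-identical body): the first-exit window schema on the
sliver `(j+1)^N > p(g_{K−j})`, `N ≤ p₀`. -/
def ThinDeepWindowTailL : Prop :=
  open Literature.MathematicalPhysics.QuantumFieldTheory.Balaban1983to89 Literature.MathematicalPhysics.QuantumFieldTheory.Balaban1983to89.T3ContinuumYM3Torus in ∀ (L N : ℕ), 0 < N → ∀ (b₀ p₀ b₂ : ℝ), 0 < b₀ → 2 < p₀ → (N : ℝ) ≤ p₀ → b₀ ≤ b₂ → ∃ (γ₁ C c : ℝ) (N' : ℕ), 0 < γ₁ ∧ γ₁ ≤ 1 ∧ 0 < c ∧ ∀ (F : T3Family) (γ : ℝ), F.L = L → 0 < γ → γ ≤ γ₁ → ∀ (K j : ℕ), 1 ≤ j → j ≤ K → ((j : ℝ) + 1) ^ N > B10.pFun b₀ p₀ (Real.sqrt (γ * ((F.L : ℝ)⁻¹) ^ (K - j))) → ∀ p : Plaq (F.P K) j,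 (T3UnitScaleTilt.gibbsK F T3UnitLawDensityEML.ℰp γ K).real {U | (∀ k, k < j → PlaqSmall (T3UnitScaleTilt.θBal F.L γ b₀ p₀ (K - k)) (Averaging.iter (fun i => BlockAveraging.blockAvg (P := F.P K) (j := i) T3UnitLawDensityEML.ℰp) k U)) ∧ PlaqSmall (T3UnitScaleTilt.θBal F.L γ b₂ p₀ (K - j)) (Averaging.iter (fun i => BlockAveraging.blockAvg (P := F.P K) (j := i) T3UnitLawDensityEML.ℰp) j U) ∧ T3UnitScaleTilt.θBal F.L γ b₀ p₀ (K - j) ≤ GaugeGroup.dist1 (GaugeField.plaqHol (Averaging.iter (fun i => BlockAveraging.blockAvg (P := F.P K) (j := i) T3UnitLawDensityEML.ℰp) j U) p)} ≤ C * ((γ * ((F.L : ℝ)⁻¹) ^ (K - j))⁻¹) ^ N' * Real.exp (-(c * B10.pFun b₀ p₀ (Real.sqrt (γ * ((F.L : ℝ)⁻¹) ^ (K - j))) ^ 2))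

/-- The local copy IS the route decl (definitional). -/
theorem thinDeepWindowTailL_iff :
    ThinDeepWindowTailL ↔ Summit.QuantumFields.YangMills.Theses.RandomisedStokes.ThinDeepWindowTailL := Iff.rfl

/-- THE SLIVER LIES IN A LINEAR WINDOW: if `(j+1)^N > p(g_{K−j}) = b₀(1 + log g_{K−j}⁻¹)^{p₀}` with `N ≤ p₀`, `1 ≤ j ≤ K`, `0 < γ ≤ 1`,
`b₀, p₀ > 0`, `L > 1`, then `K < (⌈4/(b₀^{1/p₀}·log L)⌉₊ + 1)·j`. [folklore] -/
theorem sliver_linear_window {L : ℕ} (hL : 1 < L) {γ b₀ p₀ : ℝ} (hγ : 0 < γ) (hγ1 : γ ≤ 1) (hb₀ : 0 < b₀)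
    (hp₀ : 0 < p₀) {N : ℕ} (hN : (N : ℝ) ≤ p₀) {K j : ℕ} (hj : 1 ≤ j) (hjK : j ≤ K)
    (hs : ((j : ℝ) + 1) ^ N > Literature.MathematicalPhysics.QuantumFieldTheory.Balaban1983to89.B10.pFun b₀ p₀ (Real.sqrt (γ * ((L : ℝ)⁻¹) ^ (K - j)))) :
    K < (⌈4 / (b₀ ^ (1 / p₀) * Real.log L)⌉₊ + 1) * j := by
  have hL1 : (1 : ℝ) < L := by exact_mod_cast hL
  have hlogL : 0 < Real.log L := Real.log_pos hL1
  set h : ℕ := K - j with hh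
  have hK : K = j + h := by omega
  set g : ℝ := Real.sqrt (γ * ((L : ℝ)⁻¹) ^ h) with hg
  have hx : 0 < γ * ((L : ℝ)⁻¹) ^ h := by positivity
  have hlog : Real.log g⁻¹ = ((h : ℝ) * Real.log L - Real.log γ) / 2 := by
    rw [hg, Real.log_inv, Real.log_sqrt hx.le, Real.log_mul hγ.ne' (by positivity), Real.log_pow, Real.log_inv]
    ring
  have hlogγ : Real.log γ ≤ 0 := Real.log_nonpos hγ.le hγ1
  have hu : (h : ℝ) * Real.log L / 2 ≤ 1 + Real.log g⁻¹ := by rw [hlog]; linarith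
  have hhl : 0 ≤ (h : ℝ) * Real.log L / 2 := by positivity
  have hu0 : 0 ≤ 1 + Real.log g⁻¹ := hhl.trans hu
  -- `t := b₀^{1/p₀}`, `p(g) = (t·(1 + log g⁻¹))^{p₀}`
  set t : ℝ := b₀ ^ (1 / p₀) with ht
  have ht0 : 0 < t := Real.rpow_pos_of_pos hb₀ _
  have htp : t ^ p₀ = b₀ := by
    rw [ht, ← Real.rpow_mul hb₀.le, one_div_mul_cancel hp₀.ne', Real.rpow_one]
  have hpf : Literature.MathematicalPhysics.QuantumFieldTheory.Balaban1983to89.B10.pFun b₀ p₀ g = (t * (1 + Real.log g⁻¹)) ^ p₀ := by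
    unfold Literature.MathematicalPhysics.QuantumFieldTheory.Balaban1983to89.B10.pFun
    rw [Real.mul_rpow ht0.le hu0, htp]
  -- `(j+1)^N ≤ (j+1)^{p₀}`
  have hj0 : (0 : ℝ) ≤ j := Nat.cast_nonneg _
  have hj1 : (1 : ℝ) ≤ (j : ℝ) + 1 := by linarith
  have hpow : ((j : ℝ) + 1) ^ N ≤ ((j : ℝ) + 1) ^ p₀ := by
    rw [← Real.rpow_natCast]
    exact Real.rpow_le_rpow_of_exponent_le hj1 hN
  have hlt : (t * (1 + Real.log g⁻¹)) ^ p₀ < ((j : ℝ) + 1) ^ p₀ := by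
    rw [← hpf]
    exact lt_of_lt_of_le hs hpow
  have hbase : t * (1 + Real.log g⁻¹) < (j : ℝ) + 1 :=
    (Real.rpow_lt_rpow_iff (mul_nonneg ht0.le hu0) (by linarith) hp₀).mp hlt
  -- hence `t·h·log L/2 < j + 1 ≤ 2j`, i.e. `h < 4j/(t log L)`
  have hj2 : (j : ℝ) + 1 ≤ 2 * j := by
    have : (1 : ℝ) ≤ j := by exact_mod_cast hj
    linarith
  have hmain : t * ((h : ℝ) * Real.log L / 2) < 2 * j := by
    have := mul_le_mul_of_nonneg_left hu ht0.le
    linarith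
  have hden : 0 < t * Real.log L := mul_pos ht0 hlogL
  have hh_lt : (h : ℝ) < 4 / (t * Real.log L) * j := by
    rw [div_mul_eq_mul_div, lt_div_iff₀ hden]
    linarith
  have hceil : 4 / (t * Real.log L) ≤ (⌈4 / (t * Real.log L)⌉₊ : ℝ) := Nat.le_ceil _
  have hfin : (K : ℝ) < ((⌈4 / (t * Real.log L)⌉₊ + 1 : ℕ) : ℝ) * j := by
    rw [hK]
    push_cast
    have := mul_le_mul_of_nonneg_right hceil hj0
    linarith
  exact_mod_cast hfin

/-- Registered stub `stub_thinOfDeep` of LINE 18 (header verbatim = the skeleton's): the shared linear-window residual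
`CovariantDischarge.DeepWindowTailL` (stmt-QuantumFields-22892) at `N₁ := ⌈4/(b₀^{1/p₀}·log L)⌉₊ + 1` gives the thin residual on the sliver
(`sliver_linear_window`). [folklore] -/
theorem stub_thinOfDeep :
    Summit.QuantumFields.YangMills.Theses.CovariantDischarge.DeepWindowTailL → ThinDeepWindowTailL := by
  intro hD L N _hN b₀ p₀ b₂ hb₀ hp₀ hNp hb₂
  obtain ⟨γ₁, C, c, N', hγ₁, hγ₁1, hc, H⟩ :=
    hD L (⌈4 / (b₀ ^ (1 / p₀) * Real.log L)⌉₊ + 1) (Nat.succ_pos _) b₀ p₀ b₂ hb₀ hp₀ hb₂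
  refine ⟨γ₁, C, c, N', hγ₁, hγ₁1, hc, ?_⟩
  intro F γ hFL hγ hγle K j hj hjK hsl p
  subst hFL
  exact H F γ rfl hγ hγle K j hj hjK
    (sliver_linear_window F.hL.2 hγ (hγle.trans hγ₁1) hb₀ (by linarith) hNp hj hjK hsl) p

/-- The door between the two ROUTE decls BY NAME: `CovariantDischarge.DeepWindowTailL → RandomisedStokes.ThinDeepWindowTailL`
(stmt-QuantumFields-22892 ⇒ stmt-QuantumFields-23919). [folklore] -/
theorem thinDeepWindowTailL_of_deepWindowTailL
    (hD : Summit.QuantumFields.YangMills.Theses.CovariantDischarge.DeepWindowTailL) :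
    Summit.QuantumFields.YangMills.Theses.RandomisedStokes.ThinDeepWindowTailL :=
  stub_thinOfDeep hD

end Summit.QuantumFields.YangMills.Theorems.RandomisedStokes
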